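import Summits.QuantumFields.YangMills.Theorems.BalabanLadderUVRecord12Defs
import Literature.MathematicalPhysics.QuantumFieldTheory.Balaban1983to89.Node00.N23Dossier
import HarnessLib

/-!
# BalabanLadder ∕ UV — kernels for the Stage-12 UV packages: Track A's composition at every `N`, the θ ⇒ (D, w) change of currency, the Stage-0
# projections (the bodies of `UVD59 N` ∕ `BalabanLadder.UV`), and the T⁴ apex AT the pinned record

OS-ASSEMBLY BOOKKEEPING (cell `ym-fleet`, seat `ym-osasm-p1`, director-ym R136 (iii); `--supports stmt-QuantumFields-19351`).  Pure theorems over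
`Theorems/BalabanLadderUVRecord12Defs.lean` (`UVAtParams12`, `UVAtRecord12C`); 0 `sorry`, 0 `def`, standard axioms; COUNT-NEUTRAL — every hypothesis is
an OPEN item's text used by modus ponens.

* §1 `uvAtParams12_of_chain` — the detail route's rev-15 deciding composition, θ-keyed, for EVERY `N`: the four item texts of
  `route-QuantumFields-BalabanUVNodes` rev 15 (`Record12Inhabited` ∕ `StabilityBAtRecordR12e` ∕ `EndpointGivenBR12` ∕ `SpineGivenEndpointR12`, with `2 ↦ N`,
  copied INLINE so that this module does not import that Theses file and survives its restates; the items feed it by unfolding) ⇒ `UVAtParams12 N`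
  — i.e. `BalabanUVNodes.closes` STOPPED one line before its Stage-0 projection; `uvAtRecord12C_of_recordChain` — the same in the (D, w) currency of
  `Theorems.UVOtherGroups.uvD59_of_recordChain₁₂C`.
* §2 `uvAtRecord12C_of_uvAtParams12` (θ ⇒ (D, w), `Node00.exists_world_isRecordOfRecord₁₂C` with the full window `w.γ = θ.γ`), `params_of_uvAtRecord12C`
  ((D, w) ⇒ θ without the unity clause, `Node00.exists_provisos_of_isRecordOfRecord₁₂C`), and the Stage-0 projections `stage0_of_uvAtParams12` ∕
  `stage0_of_uvAtRecord12C` whose conclusion is VERBATIM the body of `YMDAG.UVSplit.UVD59 N` (at `N = 2`: of `Summit.QuantumFields.YangMills.Theses.BalabanLadder.UV`)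
  — a consumer closes the goal `UVD59 N` ∕ `BalabanLadder.UV` by `exact stage0_of_uvAtParams12 h` (definitional unfolding; certified in the desk scratch
  `UV_Record12_byname_scratch.lean`, evidence on stmt-QuantumFields-19351, together with `(fun h0 h1 h2 h3 => …) = @BalabanUVNodes.closes := rfl`).
  ROUTE-INDEPENDENT BY DESIGN (standing build rule 2026-08-26T18:55Z): this module imports no `Theses` file and no module in a route's cone.
* §3 the T⁴ apex AT THE PINNED RECORD in its three currencies (∀- and ∃-tuned-sequence readings `ContinuumYM4Torus` ∕ `ContinuumYM4TorusE`, and the law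
  reading `ContinuumYM4TorusLaw`: ONE OS-positive torus-covariant probability law per tuned sequence), for both packages.

HONEST FRAMING.  Knits of a CONDITIONAL chain; the packages are HYPOTHESES (Track A's four items are open: typed 28∕28, discharged 5∕28 at node
level); one finite four-torus programme per family at fixed ε; NOT infinite volume, NOT OS on ℝ⁴, NOT a mass gap, NOT Clay.
-/

set_option autoImplicit false

namespace Summit.QuantumFields.YangMills.Cruxes.UV.Record12

open Literature.MathematicalPhysics.QuantumFieldTheory.Balaban1983to89
open Literature.MathematicalPhysics.QuantumFieldTheory.Balaban1983to89.T4Continuum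
open Literature.MathematicalPhysics.QuantumFieldTheory.Balaban1983to89.T4ContinuumYM4Torus

/-! ## §1 Track A's deciding composition, stopped before the Stage-0 projection -/

section Chain

variable {N : ℕ} [NeZero N]

/-- **THE θ-KEYED STAGE-12 UV PACKAGE FROM THE FOUR ITEM TEXTS** (rev 15 of `route-QuantumFields-BalabanUVNodes`, `2 ↦ N`): inhabitation of the
admissible unity tuples (K0′) · (B) + window at some such tuple (K1′) · END given (B) + window (K2′) · hybrid-NE7 spine given (B) + END (K3′) ⟹
`UVAtParams12 N`.  Literally the term of `BalabanUVNodes.closes` minus its last line; at `N = 2` the route items ARE these binders (by unfolding). -/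
theorem uvAtParams12_of_chain
    (h0 : ∀ F : T4Family, ∃ θ : Node00.Stage12Params F N, θ.Provisos₁₂ F N ∧ (θ.ZtUnity F N ∧ θ.SlotsNondegenerate) ∧ θ.Admissible F N)
    (h1 : ∀ F : T4Family, (∃ θ : Node00.Stage12Params F N, θ.Provisos₁₂ F N ∧ (θ.ZtUnity F N ∧ θ.SlotsNondegenerate) ∧ θ.Admissible F N) →
      ∃ (θ : Node00.Stage12Params F N) (h : θ.Provisos₁₂ F N), (θ.ZtUnity F N ∧ θ.SlotsNondegenerate) ∧ θ.Admissible F N ∧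
        B16.EndStatementBPrinted (Node00.datumOfRecord₁₂ F N θ h).C ∧ ∃ γ₁ : ℝ, 0 < γ₁ ∧ ∀ γ : ℝ, 0 < γ → γ ≤ γ₁ →
          ∃ P : B12.RunParams, 1 ≤ P.K ∧ ((Node00.datumOfRecord₁₂ F N θ h).C P).flow.InInterval γ P.K)
    (h2 : ∀ (F : T4Family) (θ : Node00.Stage12Params F N) (h : θ.Provisos₁₂ F N), (θ.ZtUnity F N ∧ θ.SlotsNondegenerate) → θ.Admissible F N →
      B16.EndStatementBPrinted (Node00.datumOfRecord₁₂ F N θ h).C → (∃ γ₁ : ℝ, 0 < γ₁ ∧ ∀ γ : ℝ, 0 < γ → γ ≤ γ₁ →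
        ∃ P : B12.RunParams, 1 ≤ P.K ∧ ((Node00.datumOfRecord₁₂ F N θ h).C P).flow.InInterval γ P.K) →
      DagBinding.EndpointExistence (Node00.datumOfRecord₁₂ F N θ h).C.toB12)
    (h3 : ∀ (F : T4Family) (θ : Node00.Stage12Params F N) (h : θ.Provisos₁₂ F N), (θ.ZtUnity F N ∧ θ.SlotsNondegenerate) → θ.Admissible F N →
      B16.EndStatementBPrinted (Node00.datumOfRecord₁₂ F N θ h).C → DagBinding.EndpointExistence (Node00.datumOfRecord₁₂ F N θ h).C.toB12 →
      T4ApexHybrid.HybridNE7Under (Node00.datumOfRecord₁₂ F N θ h) (DagBinding.EndpointExistence (Node00.datumOfRecord₁₂ F N θ h).C.toB12)) :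
    UVAtParams12 N := by
  intro F
  obtain ⟨θ, h, hU, hθ, hb, hwin⟩ := h1 F (h0 F)
  have hend : DagBinding.EndpointExistence (Node00.datumOfRecord₁₂ F N θ h).C.toB12 := h2 F θ h hU hθ hb hwin
  exact ⟨θ, h, hU, hθ, hb, hwin, hend, h3 F θ h hU hθ hb hend⟩

/-- **THE (D, w)-KEYED STAGE-12 UV PACKAGE FROM THE FOUR-CHAIN IN RECORD CURRENCY** (the binders of `Theorems.UVOtherGroups.uvD59_of_recordChain₁₂C`
verbatim): inhabitation of the Stage-12 record class · (B) + window at some record · END given (B) + window · spine given (B) + END ⟹ `UVAtRecord12C N`. -/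
theorem uvAtRecord12C_of_recordChain
    (h0 : ∀ F : T4Family, ∃ (D : FiniteEpsData F (Matrix.specialUnitaryGroup (Fin N) ℂ)) (w : DagBinding.WorldP),
      Node00.IsRecordOfRecord₁₂C F N D w)
    (h1 : ∀ F : T4Family, (∃ (D : FiniteEpsData F (Matrix.specialUnitaryGroup (Fin N) ℂ)) (w : DagBinding.WorldP),
        Node00.IsRecordOfRecord₁₂C F N D w) →
      ∃ (D : FiniteEpsData F (Matrix.specialUnitaryGroup (Fin N) ℂ)) (w : DagBinding.WorldP), Node00.IsRecordOfRecord₁₂C F N D w ∧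
        B16.EndStatementBPrinted D.C ∧ ∃ γ₁ : ℝ, 0 < γ₁ ∧ ∀ γ : ℝ, 0 < γ → γ ≤ γ₁ →
          ∃ P : B12.RunParams, 1 ≤ P.K ∧ (D.C P).flow.InInterval γ P.K)
    (h2 : ∀ (F : T4Family) (D : FiniteEpsData F (Matrix.specialUnitaryGroup (Fin N) ℂ)) (w : DagBinding.WorldP),
      Node00.IsRecordOfRecord₁₂C F N D w → B16.EndStatementBPrinted D.C → (∃ γ₁ : ℝ, 0 < γ₁ ∧ ∀ γ : ℝ, 0 < γ → γ ≤ γ₁ →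
        ∃ P : B12.RunParams, 1 ≤ P.K ∧ (D.C P).flow.InInterval γ P.K) → DagBinding.EndpointExistence D.C.toB12)
    (h3 : ∀ (F : T4Family) (D : FiniteEpsData F (Matrix.specialUnitaryGroup (Fin N) ℂ)) (w : DagBinding.WorldP),
      Node00.IsRecordOfRecord₁₂C F N D w → B16.EndStatementBPrinted D.C → DagBinding.EndpointExistence D.C.toB12 →
        T4ApexHybrid.HybridNE7Under D (DagBinding.EndpointExistence D.C.toB12)) :
    UVAtRecord12C N := by
  intro F
  obtain ⟨D, w, hR, hb, hwin⟩ := h1 F (h0 F)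
  have hend : DagBinding.EndpointExistence D.C.toB12 := h2 F D w hR hb hwin
  exact ⟨D, w, hR, hb, hwin, hend, h3 F D w hR hb hend⟩

end Chain

/-! ## §2 The change of currency θ ⇒ (D, w) and the Stage-0 projections (the bodies of `UVD59 N` ∕ `BalabanLadder.UV`) -/

section Projections

variable {N : ℕ} [NeZero N]

/-- **θ ⇒ (D, w)**: the θ-keyed package gives the (D, w)-keyed one — every admissible Stage-12 tuple with provisos IS a Stage-12 record at a world bound to
its construction, with the full window `w.γ = θ.γ` (`Node00.exists_world_isRecordOfRecord₁₂C`; `0 < θ.γ` from admissibility); the unity clause is dropped. -/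
theorem uvAtRecord12C_of_uvAtParams12 (h : UVAtParams12 N) : UVAtRecord12C N := by
  intro F
  obtain ⟨θ, hP, -, hθ, hb, hwin, hend, hNE⟩ := h F
  obtain ⟨w, hw, -⟩ := Node00.exists_world_isRecordOfRecord₁₂C F N θ hP hθ ⟨hθ.toStage9.gamma_pos, le_rfl⟩
  exact ⟨Node00.datumOfRecord₁₂ F N θ hP, w, hw, hb, hwin, hend, hNE⟩

/-- **(D, w) ⇒ θ, without unity**: a (D, w)-keyed package reads through Bałaban's parameters — the record predicate certifies admissible θ with provisos
and `D = datumOfRecord₁₂ F N θ h` (`Node00.exists_provisos_of_isRecordOfRecord₁₂C`); the partition-of-unity ∕ non-degeneracy clause of `UVAtParams12` is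
NOT recoverable from the record predicate (it is K0′'s extra datum), so this is not a converse of `uvAtRecord12C_of_uvAtParams12`. -/
theorem params_of_uvAtRecord12C (h : UVAtRecord12C N) (F : T4Family) :
    ∃ (θ : Node00.Stage12Params F N) (hP : θ.Provisos₁₂ F N), θ.Admissible F N ∧
      B16.EndStatementBPrinted (Node00.datumOfRecord₁₂ F N θ hP).C ∧
      (∃ γ₁ : ℝ, 0 < γ₁ ∧ ∀ γ : ℝ, 0 < γ → γ ≤ γ₁ →
        ∃ P : B12.RunParams, 1 ≤ P.K ∧ ((Node00.datumOfRecord₁₂ F N θ hP).C P).flow.InInterval γ P.K) ∧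
      DagBinding.EndpointExistence (Node00.datumOfRecord₁₂ F N θ hP).C.toB12 ∧
      T4ApexHybrid.HybridNE7Under (Node00.datumOfRecord₁₂ F N θ hP)
        (DagBinding.EndpointExistence (Node00.datumOfRecord₁₂ F N θ hP).C.toB12) := by
  obtain ⟨D, w, hR, hb, hwin, hend, hNE⟩ := h F
  obtain ⟨θ, hP, hθ, rfl⟩ := Node00.exists_provisos_of_isRecordOfRecord₁₂C hR
  exact ⟨θ, hP, hθ, hb, hwin, hend, hNE⟩

/-- **THE STAGE-0 PROJECTION OF THE (D, w)-KEYED PACKAGE** — conclusion VERBATIM the body of `YMDAG.UVSplit.UVD59 N` (at `N = 2`: of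
`Summit.QuantumFields.YangMills.Theses.BalabanLadder.UV`): on every family a Stage-0 datum of record with (B), END and the spine
(`Node00.isDatumOfRecord₀_of_isRecordOfRecord₁₂C`; the window and the world are forgotten).  A consumer closes `UVD59 N` ∕ `BalabanLadder.UV` by `exact`. -/
theorem stage0_of_uvAtRecord12C (h : UVAtRecord12C N) (F : T4Family) :
    ∃ D : FiniteEpsData F (Matrix.specialUnitaryGroup (Fin N) ℂ), Node00.IsDatumOfRecord₀ F N D ∧ B16.EndStatementBPrinted D.C ∧
      DagBinding.EndpointExistence D.C.toB12 ∧ T4ApexHybrid.HybridNE7Under D (DagBinding.EndpointExistence D.C.toB12) := by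
  obtain ⟨D, w, hR, hb, -, hend, hNE⟩ := h F
  exact ⟨D, Node00.isDatumOfRecord₀_of_isRecordOfRecord₁₂C hR, hb, hend, hNE⟩

/-- **THE STAGE-0 PROJECTION OF THE θ-KEYED PACKAGE** — the last line of `BalabanUVNodes.closes` with `2 ↦ N` (`Node00.isDatumOfRecord₀_datumOfRecord₁₂`,
`rfl`); conclusion VERBATIM the body of `YMDAG.UVSplit.UVD59 N` ∕ (at `N = 2`) of `BalabanLadder.UV`. -/
theorem stage0_of_uvAtParams12 (h : UVAtParams12 N) (F : T4Family) :
    ∃ D : FiniteEpsData F (Matrix.specialUnitaryGroup (Fin N) ℂ), Node00.IsDatumOfRecord₀ F N D ∧ B16.EndStatementBPrinted D.C ∧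
      DagBinding.EndpointExistence D.C.toB12 ∧ T4ApexHybrid.HybridNE7Under D (DagBinding.EndpointExistence D.C.toB12) := by
  obtain ⟨θ, hP, -, -, hb, -, hend, hNE⟩ := h F
  exact ⟨Node00.datumOfRecord₁₂ F N θ hP, Node00.isDatumOfRecord₀_datumOfRecord₁₂ F N θ hP, hb, hend, hNE⟩

end Projections

/-! ## §3 The T⁴ apex AT THE PINNED RECORD, in its three currencies -/

section Apex

variable {N : ℕ} [NeZero N]

/-- **THE APEX AT THE θ-KEYED RECORD, ∀- and ∃-readings**: on every family an admissible unity tuple θ with provisos whose datum of record has endpoint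
existence AND `ContinuumYM4Torus ∧ ContinuumYM4TorusE` — for all small `γ`, `g` and every (resp. some) tuned bare-coupling sequence the joint expectations of
the unit-scale averaged loop variables converge as `ε → 0`, limit points agree, are reflection positive and torus covariant
(`Node00.continuumYM4Torus_datumOfRecord₁₂` + `continuumYM4TorusE_of_endpoint`). -/
theorem apex_of_uvAtParams12 (h : UVAtParams12 N) (F : T4Family) :
    ∃ (θ : Node00.Stage12Params F N) (hP : θ.Provisos₁₂ F N), (θ.ZtUnity F N ∧ θ.SlotsNondegenerate) ∧ θ.Admissible F N ∧
      DagBinding.EndpointExistence (Node00.datumOfRecord₁₂ F N θ hP).C.toB12 ∧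
      ContinuumYM4Torus (Node00.datumOfRecord₁₂ F N θ hP) ∧ ContinuumYM4TorusE (Node00.datumOfRecord₁₂ F N θ hP) := by
  obtain ⟨θ, hP, hU, hθ, hb, -, hend, hNE⟩ := h F
  have hT : ContinuumYM4Torus (Node00.datumOfRecord₁₂ F N θ hP) := Node00.continuumYM4Torus_datumOfRecord₁₂ F N θ hP hb hend hNE
  exact ⟨θ, hP, hU, hθ, hend, hT, continuumYM4TorusE_of_endpoint hend hT⟩

/-- **THE APEX AT THE θ-KEYED RECORD, LAW-READING**: on every family an admissible unity tuple θ with provisos AT WHOSE datum of record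
`ContinuumYM4TorusLaw` holds — for all small `γ`, `g` and every tuned bare-coupling sequence exactly ONE Borel probability law on the loop cube is the
full-sequence weak limit of the laws of the unit-scale averaged loop variables, OS-positive on every strict cone and invariant under the unit-torus
isometries (`Node00.continuumYM4TorusLaw_of_isDatumOfRecord₀`; measurability witness `Node00.avgMeasurable_of_isDatumOfRecord₀`). -/
theorem law_of_uvAtParams12 (h : UVAtParams12 N) (F : T4Family) :
    ∃ (θ : Node00.Stage12Params F N) (hP : θ.Provisos₁₂ F N), (θ.ZtUnity F N ∧ θ.SlotsNondegenerate) ∧ θ.Admissible F N ∧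
      DagBinding.EndpointExistence (Node00.datumOfRecord₁₂ F N θ hP).C.toB12 ∧
      ContinuumYM4TorusLaw (Node00.datumOfRecord₁₂ F N θ hP)
        (Node00.avgMeasurable_of_isDatumOfRecord₀ (Node00.isDatumOfRecord₀_datumOfRecord₁₂ F N θ hP)) := by
  obtain ⟨θ, hP, hU, hθ, hb, -, hend, hNE⟩ := h F
  exact ⟨θ, hP, hU, hθ, hend,
    Node00.continuumYM4TorusLaw_of_isDatumOfRecord₀ (Node00.isDatumOfRecord₀_datumOfRecord₁₂ F N θ hP) hb hend hNE⟩

/-- **THE APEX AT A (D, w)-KEYED RECORD, ∀- and ∃-readings** (`continuumYM4_torus_of_endpointExistence_nonvacuous`, B1 by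
`Node00.isPrintedAveraged_of_isRecordOfRecord₁₂C`). -/
theorem apex_of_uvAtRecord12C (h : UVAtRecord12C N) (F : T4Family) :
    ∃ (D : FiniteEpsData F (Matrix.specialUnitaryGroup (Fin N) ℂ)) (w : DagBinding.WorldP), Node00.IsRecordOfRecord₁₂C F N D w ∧
      DagBinding.EndpointExistence D.C.toB12 ∧ ContinuumYM4Torus D ∧ ContinuumYM4TorusE D := by
  obtain ⟨D, w, hR, hb, -, hend, hNE⟩ := h F
  exact ⟨D, w, hR, hend, continuumYM4_torus_of_endpointExistence_nonvacuous D
    (Node00.isPrintedAveraged_of_isRecordOfRecord₁₂C hR) hb hend hNE⟩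

/-- **THE APEX AT A (D, w)-KEYED RECORD, LAW-READING** (`Node00.continuumYM4TorusLaw_of_isDatumOfRecord₀` at
`Node00.isDatumOfRecord₀_of_isRecordOfRecord₁₂C`). -/
theorem law_of_uvAtRecord12C (h : UVAtRecord12C N) (F : T4Family) :
    ∃ (D : FiniteEpsData F (Matrix.specialUnitaryGroup (Fin N) ℂ)) (w : DagBinding.WorldP) (hR : Node00.IsRecordOfRecord₁₂C F N D w),
      DagBinding.EndpointExistence D.C.toB12 ∧
      ContinuumYM4TorusLaw D (Node00.avgMeasurable_of_isDatumOfRecord₀ (Node00.isDatumOfRecord₀_of_isRecordOfRecord₁₂C hR)) := by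
  obtain ⟨D, w, hR, hb, -, hend, hNE⟩ := h F
  exact ⟨D, w, hR, hend,
    Node00.continuumYM4TorusLaw_of_isDatumOfRecord₀ (Node00.isDatumOfRecord₀_of_isRecordOfRecord₁₂C hR) hb hend hNE⟩

end Apex

end Summit.QuantumFields.YangMills.Cruxes.UV.Record12
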